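import Summits.Parity.BatemanHorn.Theorems.RoughValueTransportBalancedSemiprimeLayerQuadraticSieveHeight
import HarnessLib

/-!
# Route `RoughValueTransport`, crux `BalancedSemiprimeLayer` (stmt-Parity-9469), line
# `smooth-modulus-twisted-hooley`: the sieve half of the quadratic case, 7/7

The line `smooth-modulus-twisted-hooley` of crux `BalancedSemiprimeLayer` (route
`RoughValueTransport`, item stmt-Parity-9469) bounds the relaxed sifted divisor family
`pairFamily f i δ c x` of a QUADRATIC coordinate `g = fᵢ = aX² + bX + c` of a Bateman–Horn system
`f` (window `m ∈ (x^{1−δ}, x^{1+δ}]`, `m ∣ g(n)`, `(m, B) = 1`, `B = |2a·disc g|`, every `fⱼ(n)`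
free of primes `< x^c`) by ONE `(k+1)`-dimensional upper-bound sieve: the pairs `(n, m)` are
booked at the value `F(n) = ∏ⱼ fⱼ(n)` and sifted by the primes `< z = x^c` (the tree's PROVED
Fundamental Lemma `SieveSequence.fundamental_lemma_explicit`); the main term comes from the window
sums of `ρ_g(m)/m` (the tree's PROVED `RhoLogSums.abs_rhoLogSum_sub_le`), the remainders ARE the
uniform Type-I information `UniformTypeI g` on dyadic blocks of `n`.  The proof is spread over
seven files `RoughValueTransportBalancedSemiprimeLayerQuadraticSieve<Part>.lean`, `<Part>` =
`Defs`, `Sequence`, `Remainder`, `Core`, `Bookkeeping`, `Height`, and the empty suffix (the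
registered stub `stub_quadraticSieve`).

This file: the registered stub `stub_quadraticSieve`.  For a QUADRATIC coordinate `g = fᵢ` of a
Bateman–Horn system `f` of `k` polynomials with `UniformTypeI (f i)` (exponents `θ, ε₀`), with
`c = min(θ, ε₀, 1/2)/16`: for every `ε > 0` there is `δ₀ = min(c, ε c^{k+1}/(8K))` such that
for all `0 < δ ≤ δ₀`, eventually `#pairFamily f i δ c x ≤ ε·x/(log x)^k` — `bound_at_height` at
the eventual largeness conditions (the Bateman–Horn partial products of `f` and `![fᵢ]` converge
to positive limits by the tree's PROVED `exists_hasBatemanHornConst_holds`; `(log x)^k = o(x^η)`).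

References: the line card `Cruxes/BalancedSemiprimeLayer/Lines/smooth-modulus-twisted-hooley.md`;
H. Halberstam, H.-E. Richert, *Sieve Methods* (1974), Thm 2.5 and Ch. 5; J. Friedlander,
H. Iwaniec, *Opera de Cribro* (2010), Cor. 6.10; C. Hooley, Acta Math. 117 (1967).  Everything
used is PROVED in the tree; no fact is vendored.
-/

noncomputable section

open Polynomial Filter Finset
open Literature.NumberTheory.Sieve
open scoped ArithmeticFunction.Moebius NumberTheorySymbols

namespace Summit.Parity.BatemanHorn.Cruxes.BalancedSemiprimeLayer.SmoothModulusTwistedHooley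

open QuadraticSieve Iwaniec1978 RhoLogSums PropertySTypeI in
/-- **stub_quadraticSieve** (registered stub of the skeleton
`Cruxes/BalancedSemiprimeLayer/Lines/smooth-modulus-twisted-hooley.lean`, reshape r1; the sieve
half of the quadratic case).  For a QUADRATIC coordinate `g = fᵢ` of a Bateman–Horn system with
uniform Type-I information (`UniformTypeI (f i)`, exponents `θ, ε₀`) the relaxed family is thin:
with `c = min(θ, ε₀, 1/2)/16` there is, for every `ε > 0`, a `δ₀ > 0` such that for all
`0 < δ ≤ δ₀`, eventually `#pairFamily f i δ c x ≤ ε·x/(log x)^k`.  Proof: `bound_at_height`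
(the pairs with `n ≤ ⌈x^{1−c}⌉` by counting rough divisors, the others by ONE `(k+1)`-dimensional
sieve on the pairs `m ∣ g(n)` booked at the value `F(n) = ∏ⱼ fⱼ(n)`, main term through the window
sums of `ρ_g(m)/m`, remainders = the Type-I hypothesis on dyadic blocks) gives
`K·(log 2/log x + 2δ)·x/(c^{k+1}(log x)^k) + C_low·x^{1−η}` with `K` free of `δ` (Mertens for `g`
and `f` through `exists_hasBatemanHornConst_holds`); take `δ₀ = min(c, ε c^{k+1}/(8K))` and absorb
the other two terms (`(log x)^k = o(x^η)`, `log x → ∞`). [folklore] -/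
theorem stub_quadraticSieve :
    ∀ (k : ℕ) (f : Fin k → ℤ[X]), IsBatemanHornSystem f → ∀ i : Fin k, (f i).natDegree = 2 →
      UniformTypeI (f i) → ∃ c : ℝ, 0 < c ∧ c ≤ 1 / 4 ∧ ∀ ε : ℝ, 0 < ε → ∃ δ₀ : ℝ, 0 < δ₀ ∧
        ∀ δ : ℝ, 0 < δ → δ ≤ δ₀ → ∀ᶠ x : ℕ in atTop,
          (#(pairFamily f i δ c x) : ℝ) ≤ ε * (x : ℝ) / Real.log x ^ k := by
  intro k f hf i hdeg hUT
  -- ## the quadratic coordinate `g = fᵢ = aX² + bX + c₀`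
  set a : ℤ := (f i).coeff 2 with ha_def
  set b : ℤ := (f i).coeff 1 with hb_def
  set c₀ : ℤ := (f i).coeff 0 with hc_def
  have hg : f i = quadPoly a b c₀ := eq_quadPoly hdeg
  have ha : 0 < a := by
    have h := hf.leadingCoeff_pos i
    rw [Polynomial.leadingCoeff, hdeg] at h
    exact h
  have hirr : Irreducible (quadPoly a b c₀) := hg ▸ hf.irreducible i
  have hΔ0 : b ^ 2 - 4 * a * c₀ ≠ 0 := disc_ne_zero ha.ne' hirr
  haveI : NeZero (4 * (b ^ 2 - 4 * a * c₀).natAbs) :=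
    ⟨mul_ne_zero (by norm_num) (Int.natAbs_ne_zero.mpr hΔ0)⟩
  obtain ⟨χ, hχ⟩ :=
    Literature.NumberTheory.QuadraticFields.exists_dirichletCharacter_four_mul _ hΔ0
  have hBn : (2 * (f i).coeff 2 *
      discrim ((f i).coeff 2) ((f i).coeff 1) ((f i).coeff 0)).natAbs = badB a b c₀ := rfl
  -- ## the system `F = ∏ⱼ fⱼ`: root counts, dimension, positivity
  have hρF : ∀ p, polyRootCountMod ![∏ j, f j] p = polyRootCountMod f p := fun p =>
    (PolyPrimeCountBrun.polyRootCountMod_eq_single_prod f p).symm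
  have hρlt : ∀ p : ℕ, p.Prime → polyRootCountMod ![∏ j, f j] p < p := fun p hp => by
    rw [hρF]; exact hf.hasNoFixedPrimeDivisor p hp
  have hρle : ∀ p : ℕ, p.Prime → polyRootCountMod ![∏ j, f j] p ≤ ∑ j, (f j).natDegree :=
    fun p hp => (PolyPrimeCountBrun.polyRootCountMod_single_le_natDegree_of_lt hp (hρlt p hp)).trans
      (natDegree_prod_le _ _)
  have hdimF := PolyPrimeCountBrun.hasSieveDimension_rootDensity_of_le hρle hρlt
  obtain ⟨K₁, hK₁⟩ := exists_hasSieveDimension ha hirr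
  have hdim := hasSieveDimension_pairDensity (hK₁ (badQ a b c₀)) hdimF
  have hκ : (0 : ℝ) < 2 * ((∑ j, (f j).natDegree : ℕ) : ℝ) + 1 := by positivity
  have hn₀i : ∀ j, ∃ N₀ : ℕ, ∀ n : ℕ, N₀ ≤ n → 1 ≤ (f j).eval (n : ℤ) := by
    intro j
    obtain ⟨N₀, hN₀⟩ := Literature.Barriers.Parity.exists_forall_le_eval_of_leadingCoeff_pos
      (hf.natDegree_pos j) (hf.leadingCoeff_pos j) 1
    exact ⟨N₀, fun n hn => by exact_mod_cast hN₀ n hn⟩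
  choose N₀ hN₀ using hn₀i
  set n₀ : ℕ := Finset.univ.sup N₀ with hn₀_def
  have hn₀ : ∀ j, ∀ n : ℕ, n₀ ≤ n → 1 ≤ (f j).eval (n : ℤ) := fun j n hn =>
    hN₀ j n ((Finset.le_sup (f := N₀) (Finset.mem_univ j)).trans hn)
  have hFpos : ∀ n : ℕ, n₀ ≤ n → 0 < (∏ j, f j).eval (n : ℤ) := fun n hn => by
    rw [Polynomial.eval_prod]
    exact Finset.prod_pos fun j _ => lt_of_lt_of_le one_pos (hn₀ j n hn)
  -- ## Bateman–Horn constants of `f` and of `![fᵢ]`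
  obtain ⟨Cf, hCf0, hCf⟩ := exists_hasBatemanHornConst_holds (ι := Fin k) hf
  obtain ⟨Cg, hCg0, hCg⟩ :=
    exists_hasBatemanHornConst_holds (ι := Fin 1) (isBatemanHornSystem_single hf i)
  -- ## the Type-I data and the exponents
  obtain ⟨θ, ε₀, KT, hθ, hε₀, y₀, hT⟩ := hUT
  rw [hBn, hg] at hT
  set ε₁ : ℝ := min ε₀ (1 / 2) with hε₁
  have hε₁0 : 0 < ε₁ := lt_min hε₀ (by norm_num)
  have hε₁ε : ε₁ ≤ ε₀ := min_le_left _ _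
  have hε₁h : ε₁ ≤ 1 / 2 := min_le_right _ _
  set cc : ℝ := min (min θ (1 / 2)) ε₁ / 16 with hccdef
  have hm0 : 0 < min (min θ (1 / 2)) ε₁ := lt_min (lt_min hθ (by norm_num)) hε₁0
  have hcc0 : 0 < cc := by rw [hccdef]; exact div_pos hm0 (by norm_num)
  have hccθ : 16 * cc ≤ θ := by
    have := (min_le_left (min θ (1 / 2)) ε₁).trans (min_le_left θ (1 / 2))
    rw [hccdef]; linarith
  have hcch : 16 * cc ≤ 1 / 2 := by
    have := (min_le_left (min θ (1 / 2)) ε₁).trans (min_le_right θ (1 / 2))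
    rw [hccdef]; linarith
  have hccε₁ : 16 * cc ≤ ε₁ := by
    have := min_le_right (min θ (1 / 2)) ε₁
    rw [hccdef]; linarith
  have hcc32 : cc ≤ 1 / 32 := by linarith
  have hcc4 : cc ≤ 1 / 4 := by linarith
  set η : ℝ := min (ε₁ / 2) cc with hηdef
  have hη0 : 0 < η := lt_min (by positivity) hcc0
  have hηε : η ≤ ε₁ / 2 := min_le_left _ _
  have hηcc : η ≤ cc := min_le_right _ _
  -- ## the constants
  set Q₀ := badQ a b c₀ with hQ₀
  set CFL : ℝ := SieveSequence.flConst (2 * ((∑ j, (f j).natDegree : ℕ) : ℝ) + 1)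
    (K₁ * (((2 * (∑ j, (f j).natDegree) + 1 : ℕ) : ℝ) ^ (2 * (∑ j, (f j).natDegree) + 1) *
      Real.exp (2 * ((∑ j, (f j).natDegree : ℕ) : ℝ) * (9 / 2 + 6 / Real.log 2)))) with hCFLdef
  have hCFL : 0 ≤ CFL :=
    (SieveSequence.flConst_pos hκ.le (lt_of_lt_of_le one_pos hdim.one_le)).le
  set Kmain : ℝ := mainConst χ Q₀ CFL Cg Cf k with hKmain
  have hQ₀pos : (0 : ℝ) < Q₀ := by exact_mod_cast Nat.pos_of_ne_zero (badQ_ne_zero a b c₀)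
  have h𝔠 : 0 < cMain χ Q₀ := const_pos ha hirr hχ (squarefree_badQ a b c₀)
  have hKmain0 : 0 < Kmain := by
    rw [hKmain, mainConst]
    refine mul_pos (mul_pos (mul_pos (by linarith) h𝔠) two_pos) ?_
    exact mul_pos (mul_pos (mul_pos (mul_pos hQ₀pos (Real.exp_pos _)) (by positivity))
      (by positivity)) (pow_pos (mul_pos two_pos mertensA₁_pos) _)
  set Clow : ℝ := lowConst χ Q₀ KT cc with hClow
  -- ## the output `c` and `δ₀(ε)`
  refine ⟨cc, hcc0, hcc4, fun ε hε => ?_⟩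
  set δ₀ : ℝ := min cc (ε * cc ^ (k + 1) / (8 * Kmain)) with hδ₀
  have hδ₀0 : 0 < δ₀ := lt_min hcc0 (by positivity)
  refine ⟨δ₀, hδ₀0, fun δ hδ hδδ₀ => ?_⟩
  have hδcc : δ ≤ cc := hδδ₀.trans (min_le_left _ _)
  have hδK : δ ≤ ε * cc ^ (k + 1) / (8 * Kmain) := hδδ₀.trans (min_le_right _ _)
  -- ## eventualities in `x`
  have hyc : Tendsto (fun x : ℕ => ⌈(x : ℝ) ^ cc⌉₊ - 1) atTop atTop :=
    (tendsto_sub_atTop_nat 1).comp (tendsto_nat_ceil_atTop.comp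
      ((tendsto_rpow_atTop hcc0).comp tendsto_natCast_atTop_atTop))
  have E1 : ∀ᶠ x : ℕ in atTop, batemanHornPartial f (⌈(x : ℝ) ^ cc⌉₊ - 1) ≤ 2 * Cf :=
    (hyc.eventually (hCf.eventually (gt_mem_nhds (by linarith)))).mono fun x h => h.le
  have E2 : ∀ᶠ x : ℕ in atTop, batemanHornPartial ![f i] (⌈(x : ℝ) ^ cc⌉₊ - 1) ≤ 2 * Cg :=
    (hyc.eventually (hCg.eventually (gt_mem_nhds (by linarith)))).mono fun x h => h.le
  have E3 : ∀ᶠ x : ℕ in atTop, (2 : ℝ) ≤ (x : ℝ) ^ (cc / 2) := eventually_nat_le_rpow (by positivity) 2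
  have E4 : ∀ᶠ x : ℕ in atTop, (sizeK a b c₀ : ℝ) < (x : ℝ) ^ cc := eventually_nat_lt_rpow hcc0 _
  have E5 : ∀ᶠ x : ℕ in atTop, (4 : ℝ) ≤ (x : ℝ) ^ (1 - δ) :=
    eventually_nat_le_rpow (by linarith) 4
  have E6 : ∀ᶠ x : ℕ in atTop, ((y₀ + n₀ + 2 : ℕ) : ℝ) ≤ (x : ℝ) ^ (1 - cc) :=
    eventually_nat_le_rpow (by linarith) _
  have E7 : ∀ᶠ x : ℕ in atTop, Real.log x ≤ (x : ℝ) ^ cc := eventually_nat_log_le_rpow hcc0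
  have E8 : ∀ᶠ x : ℕ in atTop, Clow * (x : ℝ) ^ (1 - η) ≤ ε / 4 * (x : ℝ) / Real.log x ^ k :=
    eventually_mul_rpow_le hη0 (by positivity) Clow k
  have E9 : ∀ᶠ x : ℕ in atTop, 4 * Kmain * Real.log 2 / (cc ^ (k + 1) * ε) ≤ Real.log x :=
    (Real.tendsto_log_atTop.comp tendsto_natCast_atTop_atTop).eventually_ge_atTop _
  have E0 : ∀ᶠ x : ℕ in atTop, 2 ≤ x := eventually_ge_atTop 2
  filter_upwards [E0, E1, E2, E3, E4, E5, E6, E7, E8, E9] with x hx2 h1 h2 h3 h4 h5 h6 h7 h8 h9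
  have hB := bound_at_height (χ := χ) (Cf := Cf) (Cg := Cg) (η := η) hf i ha hirr hg hBn hχ hκ hdim
    hFpos hθ hT hcc0 hcc32 hccθ hccε₁ hε₁ε hε₁h hδ hδcc hηε hηcc hx2 h1 h2 h3 h4 h5 h6 h7
  -- ## the `ε`-bookkeeping
  have hX1 : (1 : ℝ) < (x : ℝ) := by exact_mod_cast lt_of_lt_of_le one_lt_two hx2
  have hlogX : 0 < Real.log (x : ℝ) := Real.log_pos hX1
  have hxlog0 : 0 ≤ (x : ℝ) / Real.log x ^ k := by positivity
  have hKlog : Kmain * Real.log 2 / (cc ^ (k + 1) * Real.log x) ≤ ε / 4 := by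
    rw [div_le_iff₀ (by positivity)]
    have h9' := h9
    rw [div_le_iff₀ (by positivity)] at h9'
    linarith
  have hKδ : 2 * Kmain * δ / cc ^ (k + 1) ≤ ε / 4 := by
    rw [div_le_iff₀ (by positivity)]
    have hδK' := hδK
    rw [le_div_iff₀ (by positivity)] at hδK'
    linarith
  have e1 := mul_le_mul_of_nonneg_right hKlog hxlog0
  have e2 := mul_le_mul_of_nonneg_right hKδ hxlog0
  have e3 : ε / 4 * (x : ℝ) / Real.log x ^ k = ε / 4 * ((x : ℝ) / Real.log x ^ k) := by ring
  have e4 : ε * (x : ℝ) / Real.log x ^ k = ε * ((x : ℝ) / Real.log x ^ k) := by ring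
  rw [e3] at h8
  rw [e4]
  have hεx : 0 ≤ ε * ((x : ℝ) / Real.log x ^ k) := by positivity
  have hB' : (#(pairFamily f i δ cc x) : ℝ) ≤
      Kmain * Real.log 2 / (cc ^ (k + 1) * Real.log x) * ((x : ℝ) / Real.log x ^ k) +
        2 * Kmain * δ / cc ^ (k + 1) * ((x : ℝ) / Real.log x ^ k) + Clow * (x : ℝ) ^ (1 - η) := hB
  linarith only [hB', e1, e2, h8, hεx]

end Summit.Parity.BatemanHorn.Cruxes.BalancedSemiprimeLayer.SmoothModulusTwistedHooley
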